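import Summits.KontsevichZagierPeriods.KontsevichZagierPeriods.Theorems.SymplecticScissorsTypeAGenerationStubPdzCalculus
import Summits.KontsevichZagierPeriods.KontsevichZagierPeriods.Theorems.SymplecticScissorsTypeAGenerationStubPdzMemOan
import Summits.KontsevichZagierPeriods.KontsevichZagierPeriods.Theorems.SymplecticScissorsTypeAGenerationStubInterpolationCertificate
import Summits.KontsevichZagierPeriods.KontsevichZagierPeriods.Theorems.SymplecticScissorsTypeAGenerationStubRestrCZero

/-!
# `TypeAGeneration` (stmt-KontsevichZagierPeriods-18392), line `Sketch`: the INTERPOLATION CERTIFICATE (C2),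
unconditional (registered stub `stub_dlogOfUnitInterpolant`, lead assembly of wave 2)

The first sector theorem INSIDE the residual of the line `Sketch` (card stokes-compiler, engine (C2)):
**the logarithmic derivative of an admissible loop is type (a).** For `W ∈ 𝒪_{k-alg}(𝔻̄^∞)`
(`AyoubRel.Oan σ`) not involving `z_j`, with equal faces `W|_{zᵢ=1} = W|_{zᵢ=0}` (a loop in the
`zᵢ`-direction), whose straight-line interpolant `W̃ = W|_{zᵢ=0} + z_j (W − W|_{zᵢ=0})` is a unit of
`𝒪_{k-alg}(𝔻̄^∞)` (inverse `V` given — this is the ADMISSIBILITY of the certificate: `W̃` zero-free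
on the closed polydisc), the element `∂ᵢW · V|_{z_j=1} = W′/W` lies in the `k`-span of the type-(a)
elements `∂G/∂z_n − G|_{z_n=1} + G|_{z_n=0}`. Certificate (Ayoub 2015 Rem. 1.5 style, one auxiliary
variable): `Ω = ∂ᵢW̃ · V`, `Λ = ∂_jW̃ · V` (the closed 1-form `d log W̃`), `W′/W = relAC i Λ − relAC j Ω`.

Assembly of the landed wave-2 stubs: W1 `stub_pdzCalculus` (derivation rules of `∂ᵢ`), W2
`stub_pdzMemOan` (`𝒪_{k-alg}(𝔻̄^∞)` is stable under `∂ᵢ`), W3 `stub_interpolationCertificate_of`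
(the certificate given W1 and the memberships), W4 `stub_restrCZeroMemOan` (stable under the face
map `zᵢ = 0`). Consequence for the crux: inside Ayoub's algebra every `dlog` of an admissible loop is
a kernel element of the EXPECTED kind — the transcendence content of the residual `stub_residual`
starts where admissibility fails for every interpolation scheme (Ayoub Rem. 1.2; kit j022569).
-/

noncomputable section

-- `Summit.KontsevichZagierPeriods.KontsevichZagierPeriods.…` is the tree's mandated layout (single-conjunct summit).
set_option linter.dupNamespace false

namespace Summit.KontsevichZagierPeriods.KontsevichZagierPeriods.TypeAGenerationLine

open Finsupp MvPowerSeries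
open Literature.NumberTheory.Transcendental
open Literature.NumberTheory.Transcendental.AyoubRel
open Summit.KontsevichZagierPeriods.KontsevichZagierPeriods.Theses.SymplecticScissors (TypeAGeneration)

/-- **Registered stub `stub_dlogOfUnitInterpolant` — THE INTERPOLATION CERTIFICATE (C2),
unconditional.** For `W ∈ 𝒪_{k-alg}(𝔻̄^∞)` free of `z_j` (`i ≠ j`) with `W|_{zᵢ=1} = W|_{zᵢ=0}` and
`V ∈ 𝒪_{k-alg}(𝔻̄^∞)` with `(W|_{zᵢ=0} + z_j (W − W|_{zᵢ=0})) · V = 1`, the logarithmic derivative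
`∂ᵢW · V|_{z_j=1}` lies in the `k`-span of type (a). (W3 with its two membership hypotheses
discharged by W2 and W4, and the derivation rules supplied by W1.) [cite: Ayoub2015, Rem. 1.5] -/
theorem stub_dlogOfUnitInterpolant :
    ∀ (k : Type) [Field k] [CharZero k] (σ : k →+* ℂ) (i j : ℕ), i ≠ j →
      ∀ (W V : CSeries), W ∈ Oan σ → V ∈ Oan σ → ¬ UsesVar W j →
        (restrC i 0 W + X j * (W - restrC i 0 W)) * V = 1 →
        restrC i 1 W = restrC i 0 W →
        pdz i W * restrC j 1 V ∈ kSpan σ {x : CSeries | ∃ G ∈ Oan σ, ∃ n : ℕ, x = relAC n G} := by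
  intro k _ _ σ i j hij W V hW hV hWj hunit hface
  exact stub_interpolationCertificate_of stub_pdzCalculus k σ i j hij W V hW hV hWj
    (stub_pdzMemOan stub_pdzCalculus k σ W hW i).1 (stub_restrCZeroMemOan k σ W hW i).1 hunit hface

/-- The same, with the generator written as `W′ · W⁻¹`-data in the usual order of hypotheses
(loop condition first). [cite: Ayoub2015, Rem. 1.5] -/
theorem dlog_mem_kSpan_of_unit_interpolant {k : Type} [Field k] [CharZero k] (σ : k →+* ℂ)
    {i j : ℕ} (hij : i ≠ j) {W V : CSeries} (hW : W ∈ Oan σ) (hV : V ∈ Oan σ) (hWj : ¬ UsesVar W j)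
    (hface : restrC i 1 W = restrC i 0 W)
    (hunit : (restrC i 0 W + X j * (W - restrC i 0 W)) * V = 1) :
    pdz i W * restrC j 1 V ∈ kSpan σ {x : CSeries | ∃ G ∈ Oan σ, ∃ n : ℕ, x = relAC n G} :=
  stub_dlogOfUnitInterpolant k σ i j hij W V hW hV hWj hunit hface

end Summit.KontsevichZagierPeriods.KontsevichZagierPeriods.TypeAGenerationLine
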